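import Summits.ValiantsHypothesis.ValiantsHypothesis.Theses.BorderApolarity
import Literature.Computability.AlgebraicComplexity.DeterminantalComplexity
import Mathlib.LinearAlgebra.Matrix.Transvection
import Summits.ValiantsHypothesis.ValiantsHypothesis.Theorems.BorderApolarityFixedWitnessObstructionQPSocleMax
import Summits.ValiantsHypothesis.ValiantsHypothesis.Theorems.BorderApolarityFixedWitnessObstructionQPUnpad
import Summits.ValiantsHypothesis.ValiantsHypothesis.Theorems.BorderApolarityFixedWitnessObstructionQPDeborder

/-!
# Border apolarity, crux `FixedWitnessObstructionQP` — the toric-face de-bordering reduction, kernel-checked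

Route `ValiantsHypothesis/BorderApolarity`, crux item `stmt-ValiantsHypothesis-5778`, line `toric-face-debordering`
(lead prover-line-stmt-ValiantsHypothesis-5778-1; skeleton `Cruxes/FixedWitnessObstructionQP/Lines/toric-face-debordering.lean`,
reshape 3). Sorry-free COMPOSITION of the line over its three open inputs, each an explicit hypothesis stated verbatim as
registered on the crux item (`stub_toricFaceMax`, `stub_toricDeborderQP`, `stub_dcPerEventuallySuperQP`):
* `toricFaceMax_of_toricFixedPoints` — the EXTREMAL toric face normal form of a Borel-fixed border-apolar witness
  (`pp = u · in_w(g · det_m)`, `in_w` = top weighted-homogeneous component) follows from the route's crux 3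
  `ToricFixedPoints` (stmt-5779, by name) and the landed extremal socle step `stub_socleMax` (p83124);
* `toricDeborderQP_of_weightBoundMax` — the polyhedral `WeightBoundQP` (extremal toric representation ⇒ one with weights
  `≤ 2^polylog(m)`) IMPLIES the registered `stub_toricDeborderQP` (toric border ⇒ `dc(per_n) ≤ 2^polylog(m)`), through the
  landed de-bordering `stub_deborder` + `hasDetRepr_linSubst` (p78718), un-padding `stub_unpad` (p75790) and `qp_absorb`;
* `fixedWitnessObstructionQP_of_toricFaceMax` — extremal toric face normal form ∧ `ToricDeborderQP` ∧ EVENTUAL super-qp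
  `dc(per_n)` (`stub_dcPerEventuallySuperQP`, external, shared with route DetQP) ⟹ the crux;
* `FixedWitnessObstructionQP_of_toricFixedPoints` — the route's two-layer plan over this line, residue
  {`ToricFixedPoints` (crux 5779), `ToricDeborderQP` (new conjecture), eventual dc-thesis (open problem)};
* calibration `exists_extremal_zeroOne_of_mem_endOrbit`: End-orbit points are translates of TOP faces of translates for
  0/1 weights, so on `End(W) · det_m` (e.g. Grenet, `m ≥ 2ⁿ − 1`) the hypothesis of `stub_toricDeborderQP` holds.

Why the extremality clause `∀ d ∈ supp(g · det_m), ⟨w, d⟩ ≤ e` (drefute gen 3, `…/DrefuteG3StubWeightBound.md`): without it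
the padded permanent is a MIDDLE weight slice of an explicit translate of `det_m` for every `m ≥ 2n − 1`, which frees the
unrepaired weight-bound hypothesis and makes it inconsistent with the hardness input through this very composition;
extremal slices are genuine torus limits (points of `Δ(det_m)`) and that construction is never extremal.
Nothing here is conditional on an unproved NAMED fact: the open inputs are hypotheses of the theorems.
-/

open MvPolynomial
open scoped BigOperators Matrix
open Literature.Computability.AlgebraicComplexity

namespace Summit.ValiantsHypothesis.ValiantsHypothesis.Theorems.BorderApolarityFixedWitnessObstructionQP

/-- Quasi-polynomial absorption: inside the window `m ≤ 2^((log₂ n + c)^c)` the de-bordered size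
`C · ((m+1) · (2^((log₂ m + c₁)^c₁) + 1))^e₀` is again quasi-polynomial in `n`, with the explicit
exponent `c' = 4 d (d+1)`, `d = c + c₁ + C + e₀ + 2` (proof by the planner of line
`toric-face-debordering`, reproduced verbatim from the skeleton). [folklore] -/
theorem qp_absorb (c c₁ C e₀ : ℕ) : ∃ c' : ℕ, ∀ n m : ℕ,
    m ≤ 2 ^ ((Nat.log 2 n + c) ^ c) →
      C * ((m + 1) * (2 ^ ((Nat.log 2 m + c₁) ^ c₁) + 1)) ^ e₀ ≤ 2 ^ ((Nat.log 2 n + c') ^ c') := by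
  obtain ⟨d, hd_def⟩ : ∃ d : ℕ, d = c + c₁ + C + e₀ + 2 := ⟨_, rfl⟩
  refine ⟨4 * ((d + 1) * d), fun n m hm => ?_⟩
  generalize hL : Nat.log 2 n = L at hm ⊢
  have hd2 : 2 ≤ d := by omega
  obtain ⟨b, hb_def⟩ : ∃ b : ℕ, b = L + d := ⟨_, rfl⟩
  have hb2 : 2 ≤ b := by omega
  -- (i) the window exponent is dominated by `b ^ d`
  have h1 : (L + c) ^ c ≤ b ^ d :=
    calc (L + c) ^ c ≤ b ^ c := Nat.pow_le_pow_left (by omega) c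
      _ ≤ b ^ d := Nat.pow_le_pow_right (by omega) (by omega)
  -- (ii) so is `log₂ m`
  have h2 : Nat.log 2 m ≤ b ^ d :=
    calc Nat.log 2 m ≤ Nat.log 2 (2 ^ ((L + c) ^ c)) := Nat.log_mono_right hm
      _ = (L + c) ^ c := Nat.log_pow (by norm_num) _
      _ ≤ b ^ d := h1
  have hdb : d ≤ b ^ d :=
    calc d ≤ b := by omega
      _ = b ^ 1 := (pow_one b).symm
      _ ≤ b ^ d := Nat.pow_le_pow_right (by omega) (by omega)
  -- the master quantity `U = b ^ ((d+1) d)`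
  obtain ⟨U, hU_def⟩ : ∃ U : ℕ, U = b ^ ((d + 1) * d) := ⟨_, rfl⟩
  have h4 : b ^ d ≤ U := by
    rw [hU_def]
    exact Nat.pow_le_pow_right (by omega) (Nat.le_mul_of_pos_left d (by omega))
  -- (iii) the weight exponent is dominated by `U`
  have h3 : (Nat.log 2 m + c₁) ^ c₁ ≤ U := by
    have hbase : Nat.log 2 m + c₁ ≤ b ^ (d + 1) :=
      calc Nat.log 2 m + c₁ ≤ b ^ d + d := by omega
        _ ≤ b ^ d + b ^ d := by omega
        _ = 2 * b ^ d := by ring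
        _ ≤ b * b ^ d := Nat.mul_le_mul_right (b ^ d) hb2
        _ = b ^ (d + 1) := by ring
    calc (Nat.log 2 m + c₁) ^ c₁ ≤ (b ^ (d + 1)) ^ c₁ := Nat.pow_le_pow_left hbase c₁
      _ ≤ (b ^ (d + 1)) ^ d := Nat.pow_le_pow_right (Nat.one_le_pow _ _ (by omega)) (by omega)
      _ = U := by rw [hU_def, ← pow_mul]
  -- (iv)–(vii) the two factors and their product
  have h5 : m + 1 ≤ 2 ^ (U + 1) := by
    have hmU : m ≤ 2 ^ U := hm.trans (Nat.pow_le_pow_right (by norm_num) (h1.trans h4))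
    have h1U : 1 ≤ 2 ^ U := Nat.one_le_two_pow
    calc m + 1 ≤ 2 ^ U + 2 ^ U := Nat.add_le_add hmU h1U
      _ = 2 ^ (U + 1) := by ring
  have h6 : 2 ^ ((Nat.log 2 m + c₁) ^ c₁) + 1 ≤ 2 ^ (U + 1) :=
    calc 2 ^ ((Nat.log 2 m + c₁) ^ c₁) + 1 ≤ 2 ^ U + 2 ^ U :=
          Nat.add_le_add (Nat.pow_le_pow_right (by norm_num) h3) Nat.one_le_two_pow
      _ = 2 ^ (U + 1) := by ring
  have h7 : (m + 1) * (2 ^ ((Nat.log 2 m + c₁) ^ c₁) + 1) ≤ 2 ^ (2 * U + 2) :=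
    calc (m + 1) * (2 ^ ((Nat.log 2 m + c₁) ^ c₁) + 1) ≤ 2 ^ (U + 1) * 2 ^ (U + 1) :=
          Nat.mul_le_mul h5 h6
      _ = 2 ^ (2 * U + 2) := by rw [← pow_add]; ring
  -- (viii)–(ix) the power `e₀` and the constant `C`
  have h8 : ((m + 1) * (2 ^ ((Nat.log 2 m + c₁) ^ c₁) + 1)) ^ e₀ ≤ 2 ^ ((2 * U + 2) * e₀) :=
    calc ((m + 1) * (2 ^ ((Nat.log 2 m + c₁) ^ c₁) + 1)) ^ e₀ ≤ (2 ^ (2 * U + 2)) ^ e₀ :=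
          Nat.pow_le_pow_left h7 e₀
      _ = 2 ^ ((2 * U + 2) * e₀) := by rw [← pow_mul]
  have h9 : C ≤ 2 ^ C := (Nat.lt_two_pow_self).le
  have h10 : C * ((m + 1) * (2 ^ ((Nat.log 2 m + c₁) ^ c₁) + 1)) ^ e₀ ≤
      2 ^ (C + (2 * U + 2) * e₀) :=
    calc C * ((m + 1) * (2 ^ ((Nat.log 2 m + c₁) ^ c₁) + 1)) ^ e₀
          ≤ 2 ^ C * 2 ^ ((2 * U + 2) * e₀) := Nat.mul_le_mul h9 h8
      _ = 2 ^ (C + (2 * U + 2) * e₀) := by rw [← pow_add]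
  -- (x) the exponent is at most `U ^ 4`
  have hU64 : 64 ≤ U := by
    have h6d : 6 ≤ (d + 1) * d := by
      have := Nat.mul_le_mul (show 3 ≤ d + 1 by omega) hd2
      omega
    calc (64 : ℕ) = 2 ^ 6 := by norm_num
      _ ≤ 2 ^ ((d + 1) * d) := Nat.pow_le_pow_right (by norm_num) h6d
      _ ≤ b ^ ((d + 1) * d) := Nat.pow_le_pow_left hb2 _
      _ = U := by rw [hU_def]
  have hCU : C ≤ U := le_trans (by omega : C ≤ d) (hdb.trans h4)
  have heU : e₀ ≤ U := le_trans (by omega : e₀ ≤ d) (hdb.trans h4)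
  have hUU : U ≤ U ^ 2 := Nat.le_self_pow (by norm_num) U
  have h11 : C + (2 * U + 2) * e₀ ≤ U ^ 4 :=
    calc C + (2 * U + 2) * e₀ ≤ U + (2 * U + 2) * U :=
          Nat.add_le_add hCU (Nat.mul_le_mul_left (2 * U + 2) heU)
      _ = 2 * U ^ 2 + 3 * U := by ring
      _ ≤ 2 * U ^ 2 + 3 * U ^ 2 := Nat.add_le_add_left (Nat.mul_le_mul_left 3 hUU) _
      _ = 5 * U ^ 2 := by ring
      _ ≤ U * U ^ 2 := Nat.mul_le_mul_right (U ^ 2) (by omega)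
      _ ≤ U * U ^ 2 * U := Nat.le_mul_of_pos_right _ (by omega)
      _ = U ^ 4 := by ring
  -- (xi) `U ^ 4 = b ^ (4 (d+1) d) ≤ (L + c') ^ c'`
  have h12 : U ^ 4 ≤ (L + 4 * ((d + 1) * d)) ^ (4 * ((d + 1) * d)) := by
    have hdc : d ≤ 4 * ((d + 1) * d) :=
      calc d ≤ (d + 1) * d := Nat.le_mul_of_pos_left d (by omega)
        _ ≤ 4 * ((d + 1) * d) := Nat.le_mul_of_pos_left _ (by norm_num)
    have hU4 : U ^ 4 = b ^ (4 * ((d + 1) * d)) := by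
      rw [hU_def, ← pow_mul]; congr 1; ring
    rw [hU4]
    exact Nat.pow_le_pow_left (by omega) _
  exact h10.trans (Nat.pow_le_pow_right (by norm_num) (h11.trans h12))

/-- **The extremal toric face normal form follows from crux 3 and the extremal socle step.** If
`ToricFixedPoints` (route item stmt-ValiantsHypothesis-5779: every H₀-fixed border-apolar limit of translates of
`det_m` is the limit along a toric curve `u · diag((t+2)^w) · g · det_m`) holds, then for `3 ≤ n ≤ m` every
Borel-fixed border-apolar witness of the crux (W1–W5 verbatim) forces `X₀₀^(m-n) per_n = u · wHC_w^e (g · det_m)`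
with `⟨w, d⟩ ≤ e` on the support of `g · det_m` (the component is the `w`-initial form), for some `u, g ∈ GL_{m²}`,
`w : variables → ℕ`, `e : ℕ` — the statement of the registered stub `stub_toricFaceMax`, by the landed
`stub_socleMax`. [folklore] -/
theorem toricFaceMax_of_toricFixedPoints
    (h5779 : Summit.ValiantsHypothesis.ValiantsHypothesis.Theses.BorderApolarity.ToricFixedPoints) :
    ∀ (n m : ℕ) [NeZero m], 3 ≤ n → n ≤ m →
    (let act := fun (D f : MvPolynomial (Fin m × Fin m) ℂ) => ∑ e ∈ D.support, ∑ d ∈ f.support, MvPolynomial.monomial (d - e) (MvPolynomial.coeff e D * MvPolynomial.coeff d f * ∏ i ∈ e.support, (Nat.descFactorial (d i) (e i) : ℂ)); let rk := fun (p : Fin m × Fin m) => (if (m - n ≤ (p.1 : ℕ) ∧ m - n ≤ (p.2 : ℕ)) ∨ p = (0, 0) then 0 else m * m) + ((p.1 : ℕ) * m + (p.2 : ℕ)); (∃ (P : ℕ → MvPolynomial (Fin m × Fin m) ℂ) (J : ℕ → Set (MvPolynomial (Fin m × Fin m) ℂ)), (∀ t : ℕ, P t ∈ Literature.Computability.AlgebraicComplexity.glOrbit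 (Fin m × Fin m) ℂ (Literature.Computability.AlgebraicComplexity.detPoly (Fin m) ℂ)) ∧ (∀ k ≤ m, ∀ D ∈ J k, ∃ Ds : ℕ → MvPolynomial (Fin m × Fin m) ℂ, (∀ t, (Ds t).IsHomogeneous k ∧ act (Ds t) (P t) = 0) ∧ Filter.Tendsto (fun t => Literature.Computability.AlgebraicComplexity.coeffVec (Ds t)) Filter.atTop (nhds (Literature.Computability.AlgebraicComplexity.coeffVec D))) ∧ (∀ k ≤ m, ∀ (D : MvPolynomial (Fin m × Fin m) ℂ) (φ : ℕ → ℕ) (Ds : ℕ → MvPolynomial (Fin m × Fin m) ℂ), StrictMono φ → (∀ t, (Ds t).IsHomogeneous k ∧ act (Ds t) (P (φ t)) = 0) → Filter.Tendsto (fun t => Literature.Computability.AlgebraicComplexity.coeffVec (Ds t)) Filter.atTop (nhds (Literature.Computability.AlgebraicComplexity.coeffVec D)) → D ∈ J k) ∧ (∀ A : Matrix.GeneralLinearGroup (Fin m × Fin m) ℂ, let M : Matrix (Fin m × Fin m) (Fin m × Fin m) ℂ := A; (∀ i j : Fin m × Fin m, M j i ≠ 0 → rk j ≤ rk i) → (∀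 i j : Fin m × Fin m, ((m - n ≤ (i.1 : ℕ) ∧ m - n ≤ (i.2 : ℕ)) ∨ i = (0, 0)) → j ≠ i → M j i = 0) → (∀ i k j l : Fin m, m - n ≤ (i : ℕ) → m - n ≤ (k : ℕ) → m - n ≤ (j : ℕ) → m - n ≤ (l : ℕ) → M (i, j) (i, j) * M (k, l) (k, l) = M (i, l) (i, l) * M (k, j) (k, j)) → M (0, 0) (0, 0) ^ (m - n) * ∏ i ∈ Finset.univ.filter (fun i : Fin m => m - n ≤ (i : ℕ)), M (i, i) (i, i) = 1 → ∀ k ≤ m, ∀ D ∈ J k, Literature.Computability.AlgebraicComplexity.linSubst (Fin m × Fin m) ℂ Mᵀ D ∈ J k) ∧ (∀ k ≤ m, ∀ D ∈ J k, act D (Literature.Computability.AlgebraicComplexity.paddedPerPoly ℂ n m) = 0))) →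
      ∃ (u g : Matrix.GeneralLinearGroup (Fin m × Fin m) ℂ) (w : Fin m × Fin m → ℕ) (e : ℕ),
        (∀ d ∈ (linSubst (Fin m × Fin m) ℂ (g : Matrix (Fin m × Fin m) (Fin m × Fin m) ℂ) (detPoly (Fin m) ℂ)).support,
          Finsupp.weight w d ≤ e) ∧
        paddedPerPoly ℂ n m =
          linSubst (Fin m × Fin m) ℂ (u : Matrix (Fin m × Fin m) (Fin m × Fin m) ℂ)
            (MvPolynomial.weightedHomogeneousComponent w e
              (linSubst (Fin m × Fin m) ℂ (g : Matrix (Fin m × Fin m) (Fin m × Fin m) ℂ) (detPoly (Fin m) ℂ))) := by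
  intro n m inst h3 hnm
  have h1 := @h5779 n m inst h3 hnm
  have h2 := @stub_socleMax n m inst h3 hnm
  dsimp only at h1 h2 ⊢
  rintro ⟨P, J, hW1, hW2, hW3, hW4, hW5⟩
  obtain ⟨u, g, w, hQ⟩ := h1 P J hW1 ⟨hW2, hW3⟩ hW4
  exact h2 J u g w hQ hW5

/-- **`WeightBoundQP ⇒ ToricDeborderQP`, kernel-checked over the landed de-bordering.** If an extremal toric
representation of `pp_{n,m}` can always be traded for one with weights `≤ B(m) = 2^((log₂ m + c₁)^c₁)` (the polyhedral
conjecture `WeightBoundQP`), then `dc(per_n) ≤ 2^((log₂ m + c')^c')`: the bounded-weight component of `g' · det_m` is an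
honest determinant of size `C((m+1)(B(m)+1))^e₀` (`stub_deborder`), so is its translate `pp` (`hasDetRepr_linSubst`), hence
`per_n` (`stub_unpad`), and that size is quasi-polynomial in `m` (`qp_absorb` at `n = m`, `c = 1`). [folklore] -/
theorem toricDeborderQP_of_weightBoundMax
    (hW : ∃ c₁ : ℕ, ∀ (n m : ℕ) [NeZero m], 3 ≤ n → n ≤ m →
    (∃ (u g : Matrix.GeneralLinearGroup (Fin m × Fin m) ℂ) (w : Fin m × Fin m → ℕ) (e : ℕ),
        (∀ d ∈ (linSubst (Fin m × Fin m) ℂ (g : Matrix (Fin m × Fin m) (Fin m × Fin m) ℂ) (detPoly (Fin m) ℂ)).support,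
          Finsupp.weight w d ≤ e) ∧
        paddedPerPoly ℂ n m =
          linSubst (Fin m × Fin m) ℂ (u : Matrix (Fin m × Fin m) (Fin m × Fin m) ℂ)
            (MvPolynomial.weightedHomogeneousComponent w e
              (linSubst (Fin m × Fin m) ℂ (g : Matrix (Fin m × Fin m) (Fin m × Fin m) ℂ) (detPoly (Fin m) ℂ)))) →
      ∃ (u g : Matrix.GeneralLinearGroup (Fin m × Fin m) ℂ) (w : Fin m × Fin m → ℕ) (e : ℕ),
        (∀ i, w i ≤ 2 ^ ((Nat.log 2 m + c₁) ^ c₁)) ∧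
        paddedPerPoly ℂ n m =
          linSubst (Fin m × Fin m) ℂ (u : Matrix (Fin m × Fin m) (Fin m × Fin m) ℂ)
            (MvPolynomial.weightedHomogeneousComponent w e
              (linSubst (Fin m × Fin m) ℂ (g : Matrix (Fin m × Fin m) (Fin m × Fin m) ℂ) (detPoly (Fin m) ℂ)))) :
    ∃ c₁ : ℕ, ∀ (n m : ℕ) [NeZero m], 3 ≤ n → n ≤ m →
    (∃ (u g : Matrix.GeneralLinearGroup (Fin m × Fin m) ℂ) (w : Fin m × Fin m → ℕ) (e : ℕ),
        (∀ d ∈ (linSubst (Fin m × Fin m) ℂ (g : Matrix (Fin m × Fin m) (Fin m × Fin m) ℂ) (detPoly (Fin m) ℂ)).support,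
          Finsupp.weight w d ≤ e) ∧
        paddedPerPoly ℂ n m =
          linSubst (Fin m × Fin m) ℂ (u : Matrix (Fin m × Fin m) (Fin m × Fin m) ℂ)
            (MvPolynomial.weightedHomogeneousComponent w e
              (linSubst (Fin m × Fin m) ℂ (g : Matrix (Fin m × Fin m) (Fin m × Fin m) ℂ) (detPoly (Fin m) ℂ)))) →
      determinantalComplexity (perPoly (Fin n) ℂ) ≤ 2 ^ ((Nat.log 2 m + c₁) ^ c₁) := by
  obtain ⟨c₁, hW⟩ := hW
  obtain ⟨C, e₀, hD⟩ := stub_deborder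
  obtain ⟨c', hc'⟩ := qp_absorb 1 c₁ C e₀
  refine ⟨c', fun n m inst h3 hnm hrep => ?_⟩
  obtain ⟨u', g', w', e', hw', hpp'⟩ := @hW n m inst h3 hnm hrep
  have hhom : (detPoly (Fin m) ℂ).IsHomogeneous m := by simpa using detPoly_isHomogeneous (n := Fin m) (k := ℂ)
  have hcomp := hD (Fin m × Fin m) m (2 ^ ((Nat.log 2 m + c₁) ^ c₁)) m w' e' (detPoly (Fin m) ℂ)
    (g' : Matrix (Fin m × Fin m) (Fin m × Fin m) ℂ) hhom (hasDetRepr_detPoly m) hw'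
  have hpad : HasDetRepr (paddedPerPoly ℂ n m)
      (C * ((m + 1) * (2 ^ ((Nat.log 2 m + c₁) ^ c₁) + 1)) ^ e₀) := by
    rw [hpp']
    exact hasDetRepr_linSubst _ hcomp
  have hper := stub_unpad n m hnm _ hpad
  have hm : m ≤ 2 ^ ((Nat.log 2 m + 1) ^ 1) := by
    rw [pow_one]
    exact (Nat.lt_pow_succ_log_self Nat.one_lt_two m).le
  exact (determinantalComplexity_le_of_hasDetRepr hper).trans (hc' m m hm)

/-- **The line's reduction, kernel-checked.** Extremal toric face normal form of fixed witnesses (`hT`, the registered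
`stub_toricFaceMax`) ∧ `ToricDeborderQP` (`hTD`, the registered `stub_toricDeborderQP`: toric border ⇒ affine at
quasi-polynomial cost) ∧ eventual super-quasi-polynomial `dc(per_n)` (`hdc`, the registered `stub_dcPerEventuallySuperQP`)
imply the crux: given `c`, take `c'` from `qp_absorb c c₁ 1 1` and `n₀ := max n₁ 3` with `n₁` from `hdc c'`; a witness at
`(n, m)` in the window gives `dc(per_n) ≤ 2^((log₂ m + c₁)^c₁) ≤ 2^((log₂ n + c')^c') < dc(per_n)`. [folklore] -/
theorem fixedWitnessObstructionQP_of_toricFaceMax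
    (hT : ∀ (n m : ℕ) [NeZero m], 3 ≤ n → n ≤ m →
    (let act := fun (D f : MvPolynomial (Fin m × Fin m) ℂ) => ∑ e ∈ D.support, ∑ d ∈ f.support, MvPolynomial.monomial (d - e) (MvPolynomial.coeff e D * MvPolynomial.coeff d f * ∏ i ∈ e.support, (Nat.descFactorial (d i) (e i) : ℂ)); let rk := fun (p : Fin m × Fin m) => (if (m - n ≤ (p.1 : ℕ) ∧ m - n ≤ (p.2 : ℕ)) ∨ p = (0, 0) then 0 else m * m) + ((p.1 : ℕ) * m + (p.2 : ℕ)); (∃ (P : ℕ → MvPolynomial (Fin m × Fin m) ℂ) (J : ℕ → Set (MvPolynomial (Fin m × Fin m) ℂ)), (∀ t : ℕ, P t ∈ Literature.Computability.AlgebraicComplexity.glOrbit (Fin m × Fin m) ℂ (Literature.Computability.AlgebraicComplexity.detPoly (Fin m) ℂ)) ∧ (∀ k ≤ m, ∀ D ∈ J k, ∃ Ds : ℕ → MvPolynomial (Fin m × Fin m) ℂ, (∀ t, (Ds t).IsHomogeneous k ∧ act (Ds t) (P t) = 0) ∧ Filter.Tendsto (fun t => Literature.Computability.AlgebraicComplexity.coeffVec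 (Ds t)) Filter.atTop (nhds (Literature.Computability.AlgebraicComplexity.coeffVec D))) ∧ (∀ k ≤ m, ∀ (D : MvPolynomial (Fin m × Fin m) ℂ) (φ : ℕ → ℕ) (Ds : ℕ → MvPolynomial (Fin m × Fin m) ℂ), StrictMono φ → (∀ t, (Ds t).IsHomogeneous k ∧ act (Ds t) (P (φ t)) = 0) → Filter.Tendsto (fun t => Literature.Computability.AlgebraicComplexity.coeffVec (Ds t)) Filter.atTop (nhds (Literature.Computability.AlgebraicComplexity.coeffVec D)) → D ∈ J k) ∧ (∀ A : Matrix.GeneralLinearGroup (Fin m × Fin m) ℂ, let M : Matrix (Fin m × Fin m) (Fin m × Fin m) ℂ := A; (∀ i j : Fin m × Fin m, M j i ≠ 0 → rk j ≤ rk i) → (∀ i j : Fin m × Fin m, ((m - n ≤ (i.1 : ℕ) ∧ m - n ≤ (i.2 : ℕ)) ∨ i = (0, 0)) → j ≠ i → M j i = 0) → (∀ i k j l : Fin m, m - n ≤ (i : ℕ) → m - n ≤ (k : ℕ) → m - n ≤ (j : ℕ) → m - n ≤ (l : ℕ) → M (i, j) (i, j) * M (k, l) (k, l) = M (i, l) (i,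 l) * M (k, j) (k, j)) → M (0, 0) (0, 0) ^ (m - n) * ∏ i ∈ Finset.univ.filter (fun i : Fin m => m - n ≤ (i : ℕ)), M (i, i) (i, i) = 1 → ∀ k ≤ m, ∀ D ∈ J k, Literature.Computability.AlgebraicComplexity.linSubst (Fin m × Fin m) ℂ Mᵀ D ∈ J k) ∧ (∀ k ≤ m, ∀ D ∈ J k, act D (Literature.Computability.AlgebraicComplexity.paddedPerPoly ℂ n m) = 0))) →
      ∃ (u g : Matrix.GeneralLinearGroup (Fin m × Fin m) ℂ) (w : Fin m × Fin m → ℕ) (e : ℕ),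
        (∀ d ∈ (linSubst (Fin m × Fin m) ℂ (g : Matrix (Fin m × Fin m) (Fin m × Fin m) ℂ) (detPoly (Fin m) ℂ)).support,
          Finsupp.weight w d ≤ e) ∧
        paddedPerPoly ℂ n m =
          linSubst (Fin m × Fin m) ℂ (u : Matrix (Fin m × Fin m) (Fin m × Fin m) ℂ)
            (MvPolynomial.weightedHomogeneousComponent w e
              (linSubst (Fin m × Fin m) ℂ (g : Matrix (Fin m × Fin m) (Fin m × Fin m) ℂ) (detPoly (Fin m) ℂ))))
    (hTD : ∃ c₁ : ℕ, ∀ (n m : ℕ) [NeZero m], 3 ≤ n → n ≤ m →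
    (∃ (u g : Matrix.GeneralLinearGroup (Fin m × Fin m) ℂ) (w : Fin m × Fin m → ℕ) (e : ℕ),
        (∀ d ∈ (linSubst (Fin m × Fin m) ℂ (g : Matrix (Fin m × Fin m) (Fin m × Fin m) ℂ) (detPoly (Fin m) ℂ)).support,
          Finsupp.weight w d ≤ e) ∧
        paddedPerPoly ℂ n m =
          linSubst (Fin m × Fin m) ℂ (u : Matrix (Fin m × Fin m) (Fin m × Fin m) ℂ)
            (MvPolynomial.weightedHomogeneousComponent w e
              (linSubst (Fin m × Fin m) ℂ (g : Matrix (Fin m × Fin m) (Fin m × Fin m) ℂ) (detPoly (Fin m) ℂ)))) →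
      determinantalComplexity (perPoly (Fin n) ℂ) ≤ 2 ^ ((Nat.log 2 m + c₁) ^ c₁))
    (hdc : ∀ c : ℕ, ∃ n₀ : ℕ, ∀ n ≥ n₀,
    2 ^ ((Nat.log 2 n + c) ^ c) < determinantalComplexity (perPoly (Fin n) ℂ)) :
    Summit.ValiantsHypothesis.ValiantsHypothesis.Theses.BorderApolarity.FixedWitnessObstructionQP := by
  obtain ⟨c₁, hTD⟩ := hTD
  intro c
  obtain ⟨c', hc'⟩ := qp_absorb c c₁ 1 1
  obtain ⟨n₁, hn₁⟩ := hdc c'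
  refine ⟨max n₁ 3, ?_⟩
  intro n hn m inst hnm hm
  have h3 : 3 ≤ n := le_trans (le_max_right _ _) hn
  have hn₁' : n₁ ≤ n := le_trans (le_max_left _ _) hn
  have hT' := @hT n m inst h3 hnm
  dsimp only at hT' ⊢
  intro hw
  have hdc' := @hTD n m inst h3 hnm (hT' hw)
  have hle := hc' n m hm
  have hlt := hn₁ n hn₁'
  have hB : 2 ^ ((Nat.log 2 m + c₁) ^ c₁) ≤ 1 * ((m + 1) * (2 ^ ((Nat.log 2 m + c₁) ^ c₁) + 1)) ^ 1 := by
    rw [one_mul, pow_one]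
    nlinarith [Nat.zero_le m, Nat.zero_le (2 ^ ((Nat.log 2 m + c₁) ^ c₁))]
  exact (lt_irrefl _ (hlt.trans_le ((hdc'.trans hB).trans hle))).elim

/-- **The route's two-layer plan over this line, kernel-checked**: `ToricFixedPoints` (stmt-5779) ∧ `ToricDeborderQP` ∧
eventual super-qp `dc(per_n)` ⟹ `FixedWitnessObstructionQP` (stmt-5778). The honest residue of line
`toric-face-debordering` is exactly these three hypotheses. [folklore] -/
theorem FixedWitnessObstructionQP_of_toricFixedPoints
    (h5779 : Summit.ValiantsHypothesis.ValiantsHypothesis.Theses.BorderApolarity.ToricFixedPoints)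
    (hTD : ∃ c₁ : ℕ, ∀ (n m : ℕ) [NeZero m], 3 ≤ n → n ≤ m →
    (∃ (u g : Matrix.GeneralLinearGroup (Fin m × Fin m) ℂ) (w : Fin m × Fin m → ℕ) (e : ℕ),
        (∀ d ∈ (linSubst (Fin m × Fin m) ℂ (g : Matrix (Fin m × Fin m) (Fin m × Fin m) ℂ) (detPoly (Fin m) ℂ)).support,
          Finsupp.weight w d ≤ e) ∧
        paddedPerPoly ℂ n m =
          linSubst (Fin m × Fin m) ℂ (u : Matrix (Fin m × Fin m) (Fin m × Fin m) ℂ)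
            (MvPolynomial.weightedHomogeneousComponent w e
              (linSubst (Fin m × Fin m) ℂ (g : Matrix (Fin m × Fin m) (Fin m × Fin m) ℂ) (detPoly (Fin m) ℂ)))) →
      determinantalComplexity (perPoly (Fin n) ℂ) ≤ 2 ^ ((Nat.log 2 m + c₁) ^ c₁))
    (hdc : ∀ c : ℕ, ∃ n₀ : ℕ, ∀ n ≥ n₀,
    2 ^ ((Nat.log 2 n + c) ^ c) < determinantalComplexity (perPoly (Fin n) ℂ)) :
    Summit.ValiantsHypothesis.ValiantsHypothesis.Theses.BorderApolarity.FixedWitnessObstructionQP :=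
  fixedWitnessObstructionQP_of_toricFaceMax (toricFaceMax_of_toricFixedPoints h5779) hTD hdc

/-! ## Calibration: End-orbit points are translates of TOP faces of translates, for 0/1 weights -/


/-- The indicator weight of a set of variables never exceeds the degree: `⟨1_S, d⟩ ≤ |d|`. [folklore] -/
theorem weight_indicator_le {σ : Type} [DecidableEq σ] (S : Finset σ) (d : σ →₀ ℕ) :
    Finsupp.weight (fun i => if i ∈ S then 1 else 0) d ≤ Finsupp.weight (1 : σ → ℕ) d := by
  rw [Finsupp.weight_apply, Finsupp.weight_apply, Finsupp.sum, Finsupp.sum]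
  exact Finset.sum_le_sum fun i _ => by simp only [smul_eq_mul, Pi.one_apply]; split_ifs <;> omega

/-- `⟨1_S, d⟩ = |d|` iff every variable of `x^d` lies in `S`. [folklore] -/
theorem weight_indicator_eq_iff {σ : Type} [DecidableEq σ] (S : Finset σ) (d : σ →₀ ℕ) :
    Finsupp.weight (fun i => if i ∈ S then 1 else 0) d = Finsupp.weight (1 : σ → ℕ) d ↔
      ∀ i ∈ d.support, i ∈ S := by
  rw [Finsupp.weight_apply, Finsupp.weight_apply, Finsupp.sum, Finsupp.sum]
  simp only [smul_eq_mul, Pi.one_apply, mul_one]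
  constructor
  · intro h i hi
    by_contra hiS
    have hlt : ∑ j ∈ d.support, d j * (if j ∈ S then 1 else 0) < ∑ j ∈ d.support, d j := by
      apply Finset.sum_lt_sum
      · intro j _
        split_ifs <;> omega
      · refine ⟨i, hi, ?_⟩
        rw [if_neg hiS, mul_zero]
        exact Nat.pos_of_ne_zero (Finsupp.mem_support_iff.mp hi)
    omega
  · intro h
    exact Finset.sum_congr rfl fun i hi => by rw [if_pos (h i hi), mul_one]

/-- **A 0/1 diagonal substitution extracts the top face.** Setting the variables outside `S` to zero sends a form
`F` of degree `m` to its top weighted-homogeneous component for the indicator weight `1_S` (weight level `m`):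
the surviving monomials are exactly those in the variables of `S`, i.e. those of `1_S`-weight `|d| = m`. [folklore] -/
theorem linSubst_diagonal_indicator_eq_weightedHomogeneousComponent {σ : Type} [Fintype σ] [DecidableEq σ]
    (S : Finset σ) {F : MvPolynomial σ ℂ} {m : ℕ} (hF : F.IsHomogeneous m) :
    linSubst σ ℂ (Matrix.diagonal fun i => if i ∈ S then (1 : ℂ) else 0) F =
      weightedHomogeneousComponent (fun i => if i ∈ S then 1 else 0) m F := by
  ext d
  rw [coeff_linSubst_diagonal, coeff_weightedHomogeneousComponent]
  by_cases hd : coeff d F = 0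
  · rw [hd, mul_zero, ite_self]
  have hdeg : Finsupp.weight (1 : σ → ℕ) d = m := hF hd
  by_cases hall : ∀ i ∈ d.support, i ∈ S
  · have hw : Finsupp.weight (fun i => if i ∈ S then 1 else 0) d = m := by
      rw [← hdeg]
      exact (weight_indicator_eq_iff S d).2 hall
    rw [if_pos hw]
    have hprod : (d.prod fun i k => (if i ∈ S then (1 : ℂ) else 0) ^ k) = 1 := by
      rw [Finsupp.prod]
      exact Finset.prod_eq_one fun i hi => by rw [if_pos (hall i hi), one_pow]
    rw [hprod, one_mul]
  · have hw : Finsupp.weight (fun i => if i ∈ S then 1 else 0) d ≠ m := by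
      rw [← hdeg]; exact fun h => hall ((weight_indicator_eq_iff S d).1 h)
    rw [if_neg hw]
    push Not at hall
    obtain ⟨i, hi, hiS⟩ := hall
    have hprod : (d.prod fun i k => (if i ∈ S then (1 : ℂ) else 0) ^ k) = 0 := by
      rw [Finsupp.prod]
      refine Finset.prod_eq_zero hi ?_
      rw [if_neg hiS, zero_pow (Finsupp.mem_support_iff.mp hi)]
    rw [hprod, zero_mul]

/-- **End-orbit points are extremal 0/1-toric representations.** If `P = A · F` for a square matrix `A`
(invertible or not) and a form `F` of degree `m`, then `P = u · wHC_w^m (g · F)` with `u, g` INVERTIBLE, a 0/1 weight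
`w` and the top weight level `m` (`⟨w, d⟩ ≤ m` on the support): rank normal form `A = u · 1_S · g`
(`Matrix.Pivot.exists_list_transvec_mul_diagonal_mul_list_transvec`, nonzero diagonal entries moved into `u`) and
`linSubst_diagonal_indicator_eq_weightedHomogeneousComponent`. Calibration of the line: on `End(W) · det_m` (e.g. Grenet's
witnesses, `m ≥ 2ⁿ − 1`) the hypothesis of `stub_toricDeborderQP` holds (with 0/1 weights), and so does its conclusion
(`dc(per_n) ≤ m`), as does `WeightBoundQP` with `B = 1`. [folklore] -/
theorem exists_extremal_zeroOne_of_mem_endOrbit {σ : Type} [Fintype σ] [DecidableEq σ]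
    {F P : MvPolynomial σ ℂ} {m : ℕ} (hF : F.IsHomogeneous m) (hP : P ∈ endOrbit σ ℂ F) :
    ∃ (u g : GL σ ℂ) (w : σ → ℕ), (∀ i, w i ≤ 1) ∧
      (∀ d ∈ (linSubst σ ℂ (g : Matrix σ σ ℂ) F).support, Finsupp.weight w d ≤ m) ∧
      P = linSubst σ ℂ (u : Matrix σ σ ℂ)
        (weightedHomogeneousComponent w m (linSubst σ ℂ (g : Matrix σ σ ℂ) F)) := by
  obtain ⟨A, rfl⟩ := hP
  obtain ⟨L, L', D, hA⟩ := Matrix.Pivot.exists_list_transvec_mul_diagonal_mul_list_transvec A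
  -- split the diagonal: `diagonal D = diagonal D' * 1_S`, `D'` invertible, `S = {D ≠ 0}`
  set S : Finset σ := Finset.univ.filter fun i => D i ≠ 0 with hS
  set D' : σ → ℂ := fun i => if D i = 0 then 1 else D i with hD'
  have hsplit : Matrix.diagonal D =
      Matrix.diagonal D' * Matrix.diagonal (fun i => if i ∈ S then (1 : ℂ) else 0) := by
    rw [Matrix.diagonal_mul_diagonal]
    congr 1
    funext i
    simp only [hD', hS, Finset.mem_filter, Finset.mem_univ, true_and]
    by_cases h : D i = 0
    · rw [if_pos h, h]; simp
    · rw [if_neg h, if_pos h, mul_one]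
  obtain ⟨U, hU⟩ : ∃ U : Matrix σ σ ℂ,
      U = (L.map Matrix.TransvectionStruct.toMatrix).prod * Matrix.diagonal D' := ⟨_, rfl⟩
  obtain ⟨G, hG⟩ : ∃ G : Matrix σ σ ℂ, G = (L'.map Matrix.TransvectionStruct.toMatrix).prod := ⟨_, rfl⟩
  obtain ⟨E, hE⟩ : ∃ E : Matrix σ σ ℂ,
      E = Matrix.diagonal (fun i => if i ∈ S then (1 : ℂ) else 0) := ⟨_, rfl⟩
  have hUdet : U.det ≠ 0 := by
    rw [hU, Matrix.det_mul, Matrix.TransvectionStruct.det_toMatrix_prod, one_mul, Matrix.det_diagonal]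
    exact Finset.prod_ne_zero_iff.2 fun i _ => by
      simp only [hD']
      split_ifs with h
      · exact one_ne_zero
      · exact h
  have hGdet : G.det ≠ 0 := by
    rw [hG, Matrix.TransvectionStruct.det_toMatrix_prod]; exact one_ne_zero
  have hUunit : IsUnit U := (Matrix.isUnit_iff_isUnit_det U).2 (isUnit_iff_ne_zero.2 hUdet)
  have hGunit : IsUnit G := (Matrix.isUnit_iff_isUnit_det G).2 (isUnit_iff_ne_zero.2 hGdet)
  have hAfac : A = U * E * G := by
    rw [hA, hsplit, hU, hG, hE]
    simp only [Matrix.mul_assoc]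
  refine ⟨hUunit.unit, hGunit.unit, fun i => if i ∈ S then 1 else 0, fun i => ?_, fun d hd => ?_, ?_⟩
  · show (if i ∈ S then 1 else 0) ≤ 1
    split_ifs <;> omega
  · rw [hGunit.unit_spec] at hd
    have hdeg : Finsupp.weight (1 : σ → ℕ) d = m :=
      (linSubst_isHomogeneous G hF) (mem_support_iff.mp hd)
    exact (weight_indicator_le S d).trans hdeg.le
  · show linSubst σ ℂ A F = _
    rw [hUunit.unit_spec, hGunit.unit_spec, hAfac, linSubst_mul, linSubst_mul, AlgHom.comp_apply,
      AlgHom.comp_apply, hE,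
      linSubst_diagonal_indicator_eq_weightedHomogeneousComponent S (linSubst_isHomogeneous G hF)]

end Summit.ValiantsHypothesis.ValiantsHypothesis.Theorems.BorderApolarityFixedWitnessObstructionQP
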